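import Summits.HubbardSuperconductivity.HubbardSuperconductivity.Theses.AposterioriCapRg
import Literature.Analysis.Complex.CauchyTaylorBall

/-!
# Shell curvature budget: a three-point second-difference bound from Cauchy's inequality

Pure complex/real analysis in support of the line `cauchy-griffiths-source-shells` of the crux
`AposterioriOrderCriterionR` (stub `stub_shellCurvatureBudget`). No definition is introduced.

If on the window `[h/2, 2h]` (`h > 0`) a real function is
`E(t) = a + b·t + Σ_i Re g_i(t)` with every `g_i : ℂ → ℂ` holomorphic on the ball of radius
`r_i > 0` about every point `t` of the window and `‖g_i z − g_i t‖ ≤ s_i` on that ball, then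
`3E(h) − E(2h) − 2E(h/2) ≤ 6 h² Σ_i s_i / r_i²`.

Proof: Cauchy's inequality for the second derivative from a sup bound on a ball
(`Literature.Analysis.Complex.norm_iteratedDeriv_two_le_of_forall_mem_ball`, applied to
`z ↦ g_i z − g_i t`) gives `‖g_i''(t)‖ ≤ 8 s_i / r_i²` at every point of the window; restricting to
the real axis (`HasDerivAt.real_of_complex`), the real function
`χ(x) = Σ_i Re g_i(x) + (B/2) x²`, `B = 8 Σ_i s_i/r_i²`, has `χ'' = Σ_i Re g_i'' + B ≥ 0` on the
window, hence is convex there (`convexOn_of_hasDerivWithinAt2_nonneg`); evaluating convexity at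
`h = (1/3)·(2h) + (2/3)·(h/2)` and removing the affine part and the parabola gives the bound
(`(3/4)·B·h² = 6 h² Σ_i s_i/r_i²`).

Sources: Cauchy's inequalities and the convexity criterion by the sign of the second derivative,
folklore (e.g. Hörmander (1973), *An introduction to complex analysis in several variables*,
Thm. 2.2.7).
-/

noncomputable section

namespace Summit.HubbardSuperconductivity.HubbardSuperconductivity.Theorems

set_option linter.dupNamespace false -- summit = problem name (single-conjunct summit), D-0017

open Set Metric Filter

/-- Cauchy's bound for the second derivative from an oscillation bound: if `g` is holomorphic on
`ball c R`, `R > 0`, with `‖g z − g c‖ ≤ s` there, then `‖(g')'(c)‖ ≤ 8 s / R²` (apply Cauchy's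
inequality to `z ↦ g z − g c`, whose second derivative is that of `g`). [folklore] -/
private theorem norm_deriv_deriv_le_of_forall_mem_ball_norm_sub_le {g : ℂ → ℂ} {c : ℂ} {R s : ℝ}
    (hR : 0 < R) (hg : DifferentiableOn ℂ g (ball c R))
    (hs : ∀ z ∈ ball c R, ‖g z - g c‖ ≤ s) : ‖deriv (deriv g) c‖ ≤ 8 * s / R ^ 2 := by
  have h1 : DifferentiableOn ℂ (fun z => g z - g c) (ball c R) := hg.sub_const _
  have h2 := Literature.Analysis.Complex.norm_iteratedDeriv_two_le_of_forall_mem_ball hR h1 hs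
  have h3 : deriv (fun z => g z - g c) = deriv g := by
    funext z
    exact deriv_sub_const _
  rw [iteratedDeriv_succ, iteratedDeriv_one, h3] at h2
  exact h2

/-- **Shell curvature budget** (line cauchy-griffiths-source-shells, stub M2; Cauchy's inequality + convexity).
If on the window `[h/2, 2h]` a real function is `E(t) = a + b·t + Σ_i Re g_i(t)` with every `g_i` holomorphic on
the ball of radius `r_i > 0` about every point `t` of the window and `‖g_i z − g_i t‖ ≤ s_i` on that ball, then
`3E(h) − E(2h) − 2E(h/2) ≤ 6 h² Σ_i s_i / r_i²` (`‖g_i''(t)‖ ≤ 8 s_i/r_i²` by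
`Literature.Analysis.Complex.norm_iteratedDeriv_two_le_of_forall_mem_ball`, then convexity of
`x ↦ Σ_i Re g_i(x) + 4 (Σ_i s_i/r_i²) x²` on the window evaluated at `h = (2h)/3 + (2/3)(h/2)`). [folklore] -/
theorem stub_shellCurvatureBudget : ∀ (E : ℝ → ℝ) (h a b : ℝ) (n : ℕ) (g : Fin n → ℂ → ℂ) (r s : Fin n → ℝ),
    0 < h → (∀ i, 0 < r i) →
    (∀ i, ∀ t ∈ Set.Icc (h / 2) (2 * h), DifferentiableOn ℂ (g i) (Metric.ball (t : ℂ) (r i)) ∧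
      ∀ z ∈ Metric.ball (t : ℂ) (r i), ‖g i z - g i t‖ ≤ s i) →
    (∀ t ∈ Set.Icc (h / 2) (2 * h), E t = a + b * t + ∑ i, (g i t).re) →
    3 * E h - E (2 * h) - 2 * E (h / 2) ≤ 6 * h ^ 2 * ∑ i, s i / r i ^ 2 := by
  intro E h a b n g r s hh hr hg hE
  -- the window and the three evaluation points
  set D : Set ℝ := Set.Icc (h / 2) (2 * h)
  have hmem1 : h ∈ D := ⟨by linarith, by linarith⟩
  have hmem2 : 2 * h ∈ D := ⟨by linarith, by linarith⟩
  have hmem3 : h / 2 ∈ D := ⟨by linarith, by linarith⟩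
  -- the curvature constant
  set S : ℝ := ∑ i, s i / r i ^ 2
  -- (A) Cauchy: `‖g_i''(x)‖ ≤ 8 s_i / r_i²` at every point of the window
  have hA : ∀ i, ∀ x ∈ D, ‖deriv (deriv (g i)) (x : ℂ)‖ ≤ 8 * s i / r i ^ 2 := fun i x hx =>
    norm_deriv_deriv_le_of_forall_mem_ball_norm_sub_le (hr i) (hg i x hx).1 (hg i x hx).2
  -- (B) holomorphy at the real points of the window: first and second complex derivatives
  have hnhds : ∀ i, ∀ x ∈ D, Metric.ball ((x : ℝ) : ℂ) (r i) ∈ nhds ((x : ℝ) : ℂ) := fun i x _ =>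
    Metric.isOpen_ball.mem_nhds (Metric.mem_ball_self (hr i))
  have H1 : ∀ i, ∀ x ∈ D, HasDerivAt (g i) (deriv (g i) (x : ℂ)) (x : ℂ) := fun i x hx =>
    ((hg i x hx).1.differentiableAt (hnhds i x hx)).hasDerivAt
  have H2 : ∀ i, ∀ x ∈ D, HasDerivAt (deriv (g i)) (deriv (deriv (g i)) (x : ℂ)) (x : ℂ) :=
    fun i x hx => ((hg i x hx).1.analyticAt (hnhds i x hx)).deriv.differentiableAt.hasDerivAt
  -- the convexified real function `χ(x) = Σ_i Re g_i(x) + (B/2) x²`, `B = 8 S`, and its derivatives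
  have hχ1 : ∀ x ∈ D, HasDerivAt (fun y : ℝ => ∑ i, (g i y).re + 8 * S / 2 * (y * y))
      (∑ i, (deriv (g i) x).re + 8 * S * x) x := by
    intro x hx
    have hsum : HasDerivAt (fun y : ℝ => ∑ i, (g i y).re) (∑ i, (deriv (g i) x).re) x :=
      HasDerivAt.fun_sum fun i _ => (H1 i x hx).real_of_complex
    have hsq : HasDerivAt (fun y : ℝ => 8 * S / 2 * (y * y)) (8 * S / 2 * (1 * x + x * 1)) x :=
      ((hasDerivAt_id' x).fun_mul (hasDerivAt_id' x)).const_mul _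
    refine (hsum.fun_add hsq).congr_deriv ?_
    ring
  have hχ2 : ∀ x ∈ D, HasDerivAt (fun y : ℝ => ∑ i, (deriv (g i) y).re + 8 * S * y)
      (∑ i, (deriv (deriv (g i)) x).re + 8 * S) x := by
    intro x hx
    have hsum : HasDerivAt (fun y : ℝ => ∑ i, (deriv (g i) y).re)
        (∑ i, (deriv (deriv (g i)) x).re) x :=
      HasDerivAt.fun_sum fun i _ => (H2 i x hx).real_of_complex
    have hlin : HasDerivAt (fun y : ℝ => 8 * S * y) (8 * S * 1) x := (hasDerivAt_id' x).const_mul _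
    refine (hsum.fun_add hlin).congr_deriv ?_
    ring
  -- (C) `χ'' ≥ 0` on the window
  have hχ2_nonneg : ∀ x ∈ D, 0 ≤ ∑ i, (deriv (deriv (g i)) x).re + 8 * S := by
    intro x hx
    have hle : ∑ i, -(8 * (s i / r i ^ 2)) ≤ ∑ i, (deriv (deriv (g i)) x).re := by
      refine Finset.sum_le_sum fun i _ => ?_
      have h1 := (Complex.abs_re_le_norm (deriv (deriv (g i)) x)).trans (hA i x hx)
      rw [mul_div_assoc] at h1
      exact (abs_le.1 h1).1
    rw [Finset.sum_neg_distrib, ← Finset.mul_sum] at hle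
    linarith
  -- convexity of `χ` on the window
  have hconv : ConvexOn ℝ D (fun y : ℝ => ∑ i, (g i y).re + 8 * S / 2 * (y * y)) := by
    refine convexOn_of_hasDerivWithinAt2_nonneg (convex_Icc _ _)
      (f' := fun x : ℝ => ∑ i, (deriv (g i) x).re + 8 * S * x)
      (f'' := fun x : ℝ => ∑ i, (deriv (deriv (g i)) x).re + 8 * S) ?_ ?_ ?_ ?_
    · exact fun x hx => (hχ1 x hx).continuousAt.continuousWithinAt
    · exact fun x hx => (hχ1 x (interior_subset hx)).hasDerivWithinAt
    · exact fun x hx => (hχ2 x (interior_subset hx)).hasDerivWithinAt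
    · exact fun x hx => hχ2_nonneg x (interior_subset hx)
  -- (D) evaluate convexity at `h = (1/3)(2h) + (2/3)(h/2)`
  have hpt : (1 / 3 : ℝ) * (2 * h) + 2 / 3 * (h / 2) = h := by ring
  have key : (∑ i, (g i h).re) + 8 * S / 2 * (h * h) ≤
      1 / 3 * ((∑ i, (g i ((2 * h : ℝ) : ℂ)).re) + 8 * S / 2 * ((2 * h) * (2 * h))) +
        2 / 3 * ((∑ i, (g i ((h / 2 : ℝ) : ℂ)).re) + 8 * S / 2 * ((h / 2) * (h / 2))) := by
    have := hconv.2 hmem2 hmem3 (by norm_num : (0 : ℝ) ≤ 1 / 3) (by norm_num : (0 : ℝ) ≤ 2 / 3)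
      (by norm_num : (1 / 3 : ℝ) + 2 / 3 = 1)
    simp only [smul_eq_mul, hpt] at this
    exact this
  -- replace `χ` by `E` at the three points
  rw [hE h hmem1, hE (2 * h) hmem2, hE (h / 2) hmem3]
  nlinarith [key]

end Summit.HubbardSuperconductivity.HubbardSuperconductivity.Theorems

end
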